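import Literature.Analysis.FunctionSpaces.ChordalNearest
import Literature.Analysis.FunctionSpaces.PoissonDistinctValues
import HarnessLib

/-!
# The chordal-nearest point of a Poisson configuration is a.s. unique
(topic Analysis/FunctionSpaces; completes the API of the definition `chordalNearest` (`ChordalNearest`)
requested by route `ConformalPoissonDevice` of `CriticalPhenomena/Ising3DConformalLimit` with the
Poisson-process statements: under a Poisson point process whose intensity has a density with respect to
an additive Haar measure on a finite-dimensional real inner product space, for every fixed `x` almost
surely no two points of the configuration are chordally equidistant from `x`; hence the chordal-nearest
point is a.s. unique as soon as the configuration is nonempty (finite intensity), `c ↦ chordalNearest c x`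
is `P`-a.e. measurable, and jointly `(c, x) ↦ chordalNearest c x` is a.e. measurable for `P ⊗ ρ`,
`ρ` s-finite.)

Inputs: `IsPoissonPointProcess.ae_injOn` (Mecke's equation, Last–Penrose 2017 Thm 4.1, file
`PoissonDistinctValues`), the Haar-nullity of the level sets of the chordal criterion
(`addHaar_chordalCriterion_fiber`) and the measurability of `chordalNearest` away from ties
(`aemeasurable_chordalNearest`, file `ChordalNearest`).

## References

* G. Last, M. Penrose, *Lectures on the Poisson Process*, Cambridge Univ. Press (2017), Thm 4.1.
* J. F. C. Kingman, *Poisson Processes*, Oxford (1993), §2.1, §2.5.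
-/

open MeasureTheory ProbabilityTheory Set
open scoped ENNReal

namespace Literature.Analysis.FunctionSpaces

namespace IsPoissonPointProcess

variable {E : Type*} [NormedAddCommGroup E] [InnerProductSpace ℝ E] [FiniteDimensional ℝ E]
  [MeasurableSpace E] [BorelSpace E] [Nontrivial E] {μ ν : Measure E} [μ.IsAddHaarMeasure]
  {P : Measure (PointConfig E)}

/-- **A.s. no two points of the process are chordally equidistant from `x`**: under a Poisson process
whose (σ-finite) intensity is absolutely continuous with respect to an additive Haar measure, for every
`x` the chordal criterion `‖x - ·‖²/(1 + ‖·‖²)` is a.s. injective on the configuration (its level sets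
are spheres / hyperplanes, `addHaar_chordalCriterion_fiber`, and Mecke's equation, `ae_injOn`).
[cite: LastPenrose2017, Thm 4.1] -/
theorem ae_injOn_chordalCriterion [SigmaFinite ν] (h : IsPoissonPointProcess ν P) (hν : ν ≪ μ)
    (x : E) : ∀ᵐ c ∂P, Set.InjOn (chordalCriterion x) ((c : PointConfig E) : Set E) :=
  h.ae_injOn (continuous_chordalCriterion.measurable.comp (measurable_const.prodMk measurable_id))
    fun t => hν (addHaar_chordalCriterion_fiber μ x t)

/-- **Ties for the chordal-nearest point are a null event**: for every fixed `x`, a.s. the configuration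
has at most one chordal-nearest point to `x`. [cite: LastPenrose2017, Thm 4.1] -/
theorem ae_subsingleton_isChordalNearest [SigmaFinite ν] (h : IsPoissonPointProcess ν P) (hν : ν ≪ μ)
    (x : E) : ∀ᵐ c ∂P, {p | IsChordalNearest ((c : PointConfig E) : Set E) x p}.Subsingleton :=
  (h.ae_injOn_chordalCriterion hν x).mono fun _ hc => subsingleton_setOf_isChordalNearest_of_injOn hc

/-- **A.s. existence and uniqueness of the chordal-nearest point** for a Poisson process of finite
intensity with a density: for every fixed `x`, a.s. the configuration is finite and, if nonempty, has
exactly one chordal-nearest point to `x` (so `chordalNearest c x` is it, `chordalNearest_eq_of_existsUnique`).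
(The empty configuration has probability `e^{-ν(E)} > 0`, whence the proviso.) [cite: Kingman1993, §2.1] -/
theorem ae_existsUnique_isChordalNearest [IsFiniteMeasure ν] (h : IsPoissonPointProcess ν P)
    (hν : ν ≪ μ) (x : E) :
    ∀ᵐ c ∂P, ((c : PointConfig E) : Set E).Nonempty →
      ∃! p, IsChordalNearest ((c : PointConfig E) : Set E) x p := by
  filter_upwards [h.ae_finite (measure_ne_top ν _), h.ae_subsingleton_isChordalNearest hν x]
    with c hfin hsub hne
  obtain ⟨p, hp⟩ := exists_isChordalNearest hfin hne x
  exact ⟨p, hp, fun q hq => hsub hq hp⟩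

/-- For fixed `x`, `c ↦ chordalNearest c x` is `P`-a.e. measurable (count σ-algebra) under a Poisson
process with a density. [folklore] -/
theorem aemeasurable_chordalNearest [SigmaFinite ν] (h : IsPoissonPointProcess ν P) (hν : ν ≪ μ)
    (x : E) : AEMeasurable (fun c : PointConfig E => chordalNearest (c : Set E) x) P :=
  aemeasurable_chordalNearest_left x (h.ae_subsingleton_isChordalNearest hν x)

/-- **Jointly in `(c, x)`**: for `P ⊗ ρ`-a.e. `(c, x)`, `ρ` any s-finite measure on `E`, there is no tie
(Tonelli on the measurable no-tie event, `measurableSet_subsingleton_isChordalNearest_prod`). [folklore] -/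
theorem ae_subsingleton_isChordalNearest_prod [SigmaFinite ν] (h : IsPoissonPointProcess ν P)
    (hν : ν ≪ μ) (ρ : Measure E) [SFinite ρ] :
    ∀ᵐ z ∂(P.prod ρ), {q | IsChordalNearest ((z.1 : PointConfig E) : Set E) z.2 q}.Subsingleton := by
  haveI := h.isProbabilityMeasure
  set S : Set (PointConfig E × E) :=
    {z | {q | IsChordalNearest ((z.1 : PointConfig E) : Set E) z.2 q}.Subsingleton} with hS
  have hSm : MeasurableSet S := measurableSet_subsingleton_isChordalNearest_prod
  have h1 : ∀ᵐ w ∂(ρ.prod P), w.swap ∈ S := by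
    have : ∀ᵐ w ∂(ρ.prod P), w ∈ Prod.swap ⁻¹' S := by
      rw [Measure.ae_prod_mem_iff_ae_ae_mem (measurable_swap hSm)]
      exact ae_of_all _ fun x => h.ae_subsingleton_isChordalNearest hν x
    exact this
  have h2 : ∀ᵐ z ∂((ρ.prod P).map Prod.swap), z ∈ S :=
    (ae_map_iff measurable_swap.aemeasurable hSm).2 h1
  rwa [Measure.prod_swap] at h2

/-- **Jointly in `(c, x)`**: `(c, x) ↦ chordalNearest c x` is a.e. measurable for `P ⊗ ρ` (count σ-algebra
times Borel), `ρ` any s-finite measure on `E` — so annealed correlators integrating over `(c, x)` are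
not junk. [folklore] -/
theorem aemeasurable_chordalNearest_prod [SigmaFinite ν] (h : IsPoissonPointProcess ν P) (hν : ν ≪ μ)
    (ρ : Measure E) [SFinite ρ] :
    AEMeasurable (fun z : PointConfig E × E => chordalNearest (z.1 : Set E) z.2) (P.prod ρ) :=
  Literature.Analysis.FunctionSpaces.aemeasurable_chordalNearest_prod
    (h.ae_subsingleton_isChordalNearest_prod hν ρ)

end IsPoissonPointProcess

end Literature.Analysis.FunctionSpaces
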